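import Literature.Analysis.Fourier.FractalUncertaintyWeights
import Literature.Analysis.Fourier.FractalUncertaintyCells
import Literature.Analysis.Fourier.RegularSets
import Literature.Analysis.Fourier.RegularSetsPorosity
import HarnessLib

/-!
# BD18 Lemma 3.5 (the iterative step) from Proposition 3.1, in the `g`-language

Topic `Literature/Analysis/Fourier`. J. Bourgain, S. Dyatlov, *Spectral gaps without the pressure
condition*, Ann. of Math. 187 (2018), §3.4, Lemma 3.5: if `supp f̂ ⊂ Y(2L^n)` then
`supp (Ψ_n f)^ ⊂ Y(2L^{n+T})` and `‖Ψ_n f‖_{L²} ≤ (1 - τ)‖f‖_{L²}`, where the input is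
Proposition 3.1 (the unique-continuation estimate `‖f‖_{L²(U')} ≥ c₃ ‖f‖` for `supp f̂` in a
`δ`-regular set) applied to the rescaled function `f̃(x) = L^{-n/2} f(L^{-n} x)`.

`iteration_step` proves exactly this implication, sorry-free, with Proposition 3.1 entering as an
explicit hypothesis `H` (an instance, for one value of `c₃`, of BD18 Prop. 3.1 written for
`f = 𝓕⁻ h`, `h ∈ L¹ ∩ L²` vanishing off the regular set, `‖f‖_{L²} = ‖h‖_{L²}` by Plancherel):
given `g ∈ L¹ ∩ L²` vanishing off `Y(2L^n)` it produces `g' = Ψ̂_n ⋆ g` with `𝓕⁻ g' = Ψ_n · 𝓕⁻ g`,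
`g' = 0` off `Y(2L^{n+1+T})`, the pointwise bounds `|𝓕⁻ g'| ≤ |𝓕⁻ g|` everywhere and
`|𝓕⁻ g'| ≥ m_T |𝓕⁻ g|` on `X` (BD18 Lemma 3.4, `m_T = ∫_{|z| ≤ L^T/10} φ`), and the `L²` bound
`‖𝓕⁻ g'‖² ≤ (1 - (1 - c_T²) c₃) ‖𝓕⁻ g‖²`, `c_T = ∫_{|z| > L^T/8} φ` (BD18 (3.28)–(3.29)). The kernel
scale is written `L^{n+1+T}` (BD18: `Ψ_n = 1_{U_{n+1}} * φ_{n+T}`; our `T` is theirs minus one).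
Regularity of `Ỹ = L^{-n} Y(2L^n)` on scales `1` to `10N/L^n` with constant `800 C_R` comes from
`RegularSets.lean` (BD18 Lemmas 2.1–2.3); the `X`-free child cells (BD18 Lemma 2.10, "each parent
is missing a child") from `IsRegularSet.exists_missing_cell` (`RegularSetsPorosity.lean`).
-/

namespace Literature.Analysis.Fourier

open _root_.MeasureTheory Set Function Filter
open scoped FourierTransform ENNReal Convolution Pointwise Real Topology

/-- The central mass of the kernel is at most `1`. [folklore] -/
theorem mass_Icc_le_one {φ : ℝ → ℝ} (hφ0 : ∀ x, 0 ≤ φ x) (hφ : Integrable φ)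
    (hφ1 : ∫ x, φ x = 1) (R : ℝ) : ∫ z in Icc (-R) R, φ z ≤ 1 := by
  rw [← hφ1]
  exact setIntegral_le_integral hφ (Eventually.of_forall hφ0)

/-- Regularity of the rescaled fattened set `Ỹ = L^{-n}·Y(2L^n)` (BD18, proof of Lemma 3.5:
"By Lemmas 2.1–2.3 the set `Ỹ` is `δ`-regular with constant `1000C_R` on scales 1 to `α₁`",
`α₁ = 10N/L^n`; here with constant `800C_R`). [cite: BourgainDyatlov2018, Lemma 3.5] -/
theorem isRegularSet_rescaled_cthickening {Y : Set ℝ} {δ C_R N c : ℝ} (hδ0 : 0 ≤ δ) (hδ1 : δ ≤ 1)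
    (hC : 1 ≤ C_R) (hYreg : IsRegularSet Y δ C_R 1 N) (hc2 : 2 ≤ c) (hcN : c ≤ N) :
    IsRegularSet (c⁻¹ • Metric.cthickening (2 * c) Y) δ (800 * C_R) 1 (10 * (N / c)) := by
  have hc : 0 < c := by linarith
  have h1 : IsRegularSet Y δ C_R (c / 2) N := hYreg.mono_scales (by linarith) le_rfl
  have h2 := h1.cthickening hδ1 (by linarith) (by linarith) (T := 4) (by norm_num)
  rw [show (4 : ℝ) * (c / 2) = 2 * c by ring, show (2 : ℝ) * (c / 2) = c by ring] at h2
  have h3 := h2.affine (inv_pos.2 hc) 0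
  have himg : (fun x : ℝ => 0 + c⁻¹ * x) '' Metric.cthickening (2 * c) Y =
      c⁻¹ • Metric.cthickening (2 * c) Y := by
    ext z
    simp only [zero_add, Set.mem_image, Set.mem_smul_set, smul_eq_mul]
  rw [himg, inv_mul_cancel₀ hc.ne'] at h3
  have hα : (1 : ℝ) ≤ c⁻¹ * N := by
    rw [le_inv_mul_iff₀ hc, mul_one]
    exact hcN
  have h4 := h3.upper_scale hδ0 hδ1 (by positivity) hα (T := 10) (by norm_num)
  have e1 : (2 : ℝ) * 10 * (10 * 4 * C_R) = 800 * C_R := by ring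
  have e2 : (10 : ℝ) * (c⁻¹ * N) = 10 * (N / c) := by rw [inv_mul_eq_div]
  rw [e1, e2] at h4
  exact h4

/-- The rescaled fattened set lies in `[-10N/L^n, 10N/L^n]`. [cite: BourgainDyatlov2018, Lemma 3.5] -/
theorem rescaled_cthickening_subset {Y : Set ℝ} {N c : ℝ} (hY : Y ⊆ Icc (-N) N) (hYc : IsClosed Y)
    (hc : 0 < c) (hcN : c ≤ N) :
    c⁻¹ • Metric.cthickening (2 * c) Y ⊆ Icc (-(10 * (N / c))) (10 * (N / c)) := by
  intro z hz
  rw [Set.mem_smul_set] at hz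
  obtain ⟨y, hy, rfl⟩ := hz
  rw [hYc.cthickening_eq_biUnion_closedBall (by positivity), Set.mem_iUnion₂] at hy
  obtain ⟨y₀, hy₀, hyy₀⟩ := hy
  rw [Metric.mem_closedBall, Real.dist_eq, abs_le] at hyy₀
  have hb := hY hy₀
  simp only [mem_Icc, smul_eq_mul] at hb ⊢
  have hNc : 1 ≤ N / c := by rw [le_div_iff₀ hc, one_mul]; exact hcN
  constructor
  · rw [show -(10 * (N / c)) = c⁻¹ * (-(10 * N)) by ring]
    apply mul_le_mul_of_nonneg_left _ (inv_pos.2 hc).le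
    nlinarith
  · rw [show 10 * (N / c) = c⁻¹ * (10 * N) by ring]
    apply mul_le_mul_of_nonneg_left _ (inv_pos.2 hc).le
    nlinarith

/-- **The iterative step** (BD18 Lemma 3.5 from Proposition 3.1; see the module docstring).
[cite: BourgainDyatlov2018, Lemma 3.5] -/
theorem iteration_step
    {δ C_R c₃ N : ℝ} {L n T : ℕ} {X Y : Set ℝ} {φ : ℝ → ℝ} {u : ℝ → ℂ} {g : ℝ → ℂ}
    (hδ0 : 0 ≤ δ) (hδ1 : δ < 1) (hC : 1 ≤ C_R) (hL2 : 2 ≤ L)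
    (hLreg : (3 * C_R) ^ (2 / (1 - δ)) ≤ (L : ℝ)) (hn : 1 ≤ n) (hnN : (L : ℝ) ^ (n + 1) ≤ N)
    (hXreg : IsRegularSet X δ C_R N⁻¹ 1) (hX : X ⊆ Icc (-1) 1)
    (hYreg : IsRegularSet Y δ C_R 1 N) (hY : Y ⊆ Icc (-N) N)
    (hφ0 : ∀ x, 0 ≤ φ x) (hφi : Integrable φ) (hφ1 : ∫ x, φ x = 1)
    (huc : Continuous u) (hu0 : ∀ ξ, ξ ∉ Icc (-1 : ℝ) 1 → u ξ = 0)
    (hφu : ∀ x, (φ x : ℂ) = (𝓕⁻ u : ℝ → ℂ) x)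
    (H : ∀ α₁ : ℝ, 2 ≤ α₁ → ∀ Y' : Set ℝ, Y' ⊆ Icc (-α₁) α₁ →
        IsRegularSet Y' δ (800 * C_R) 1 α₁ →
        ∀ t : ℤ → ℝ, (∀ j : ℤ, Icc (t j - (4 * (L : ℝ))⁻¹) (t j + (4 * (L : ℝ))⁻¹) ⊆
          Icc (j : ℝ) ((j : ℝ) + 1)) →
        ∀ h : ℝ → ℂ, Integrable h → MemLp h 2 volume → (∀ ξ, ξ ∉ Y' → h ξ = 0) →
          c₃ * ∫ ξ, ‖h ξ‖ ^ 2 ≤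
            ∫ x in ⋃ j : ℤ, Icc (t j - (4 * (L : ℝ))⁻¹) (t j + (4 * (L : ℝ))⁻¹),
              ‖(𝓕⁻ h : ℝ → ℂ) x‖ ^ 2)
    (hg : Integrable g) (hg2 : MemLp g 2 volume)
    (hgY : ∀ ξ, ξ ∉ Metric.cthickening (2 * (L : ℝ) ^ n) Y → g ξ = 0) :
    ∃ g' : ℝ → ℂ, Integrable g' ∧ MemLp g' 2 volume ∧
      (∀ ξ, ξ ∉ Metric.cthickening (2 * (L : ℝ) ^ (n + 1 + T)) Y → g' ξ = 0) ∧
      (∀ x, ‖(𝓕⁻ g' : ℝ → ℂ) x‖ ≤ ‖(𝓕⁻ g : ℝ → ℂ) x‖) ∧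
      (∀ x ∈ X, (∫ z in Icc (-((L : ℝ) ^ T / 10)) ((L : ℝ) ^ T / 10), φ z) *
        ‖(𝓕⁻ g : ℝ → ℂ) x‖ ≤ ‖(𝓕⁻ g' : ℝ → ℂ) x‖) ∧
      ∫ x, ‖(𝓕⁻ g' : ℝ → ℂ) x‖ ^ 2 ≤
        (1 - (1 - (1 - ∫ z in Icc (-((L : ℝ) ^ T / 8)) ((L : ℝ) ^ T / 8), φ z) ^ 2) * c₃) *
          ∫ x, ‖(𝓕⁻ g : ℝ → ℂ) x‖ ^ 2 := by
  -- basic quantities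
  have hL : (0 : ℝ) < L := by exact_mod_cast (by omega : 0 < L)
  have hL1 : (1 : ℝ) ≤ L := by exact_mod_cast (by omega : 1 ≤ L)
  have hC0 : 0 < C_R := by linarith
  set c : ℝ := (L : ℝ) ^ n with hcdef
  have hc : 0 < c := by positivity
  have hc2 : 2 ≤ c := by
    calc (2 : ℝ) ≤ L := by exact_mod_cast hL2
      _ = (L : ℝ) ^ 1 := (pow_one _).symm
      _ ≤ (L : ℝ) ^ n := pow_le_pow_right₀ hL1 hn
  have hcL : c * L = (L : ℝ) ^ (n + 1) := by rw [hcdef, pow_succ]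
  have hcN : c ≤ N := by
    calc c ≤ c * L := le_mul_of_one_le_right hc.le hL1
      _ = (L : ℝ) ^ (n + 1) := hcL
      _ ≤ N := hnN
  have hN : 1 ≤ N := by linarith
  set w : ℝ := ((L : ℝ) ^ (n + 1))⁻¹ with hwdef
  have hw : 0 < w := by positivity
  have hw1 : w ≤ 1 := inv_le_one_of_one_le₀ (by rw [← hcL]; nlinarith)
  have hwc : w = (c * L)⁻¹ := by rw [hwdef, hcL]
  set ρ : ℝ := (L : ℝ) ^ (n + 1 + T) with hρdef
  have hρ : 0 < ρ := by positivity
  have hρw : ρ * w = (L : ℝ) ^ T := by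
    rw [hρdef, hwdef, pow_add]
    field_simp
  -- the coarse-grained set `U = U_{n+1}` and its weight
  set U : Set ℝ := ⋃ (k : ℤ) (_ : (X ∩ Icc ((k : ℝ) * w) (((k : ℝ) + 1) * w)).Nonempty),
      Icc ((k : ℝ) * w - w / 10) (((k : ℝ) + 1) * w + w / 10) with hUdef
  have hUm : MeasurableSet U := measurableSet_cellUnion
  have hUb : Bornology.IsBounded U :=
    (Metric.isBounded_Icc (-3 : ℝ) 3).subset (cellUnion_subset_Icc hX hw1)
  obtain ⟨wf, hwf_cont, hwf_int, ⟨Cw, hCw⟩, hwf_zero, hΨ⟩ :=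
    exists_fourier_repr_weight (U := U) hUm hUb hφi huc hu0 hφu hρ
  -- abbreviation for the real weight
  set Ψ : ℝ → ℝ := fun x => (U.indicator (fun _ => (1 : ℝ)) ⋆[ContinuousLinearMap.mul ℝ ℝ, volume]
      fun y => ρ * φ (ρ * y)) x with hΨdef
  have hΨ0 : ∀ x, 0 ≤ Ψ x := fun x => weight_nonneg hφ0 hρ x
  have hΨ1 : ∀ x, Ψ x ≤ 1 := fun x => weight_le_one hφ0 hφi hφ1 hρ x
  -- the new function `g' = wf ⋆ g`
  have hYb : Bornology.IsBounded (Metric.cthickening (2 * (L : ℝ) ^ n) Y) :=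
    ((Metric.isBounded_Icc (-N) N).subset hY).cthickening
  obtain ⟨hg'i, hg'2⟩ := integrable_and_memLp_two_convolution hwf_cont.aestronglyMeasurable hCw
    hwf_zero (Metric.isBounded_Icc (-ρ) ρ) hg hgY hYb
  set g' : ℝ → ℂ := wf ⋆[ContinuousLinearMap.mul ℂ ℂ, volume] g with hg'def
  have hFg' : ∀ x, (𝓕⁻ g' : ℝ → ℂ) x = ((Ψ x : ℝ) : ℂ) * (𝓕⁻ g : ℝ → ℂ) x := by
    intro x
    rw [hg'def, fourierInv_convolution_eq hwf_int hg x, ← hΨ x]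
  have hnormFg' : ∀ x, ‖(𝓕⁻ g' : ℝ → ℂ) x‖ = Ψ x * ‖(𝓕⁻ g : ℝ → ℂ) x‖ := by
    intro x
    rw [hFg' x, norm_mul, Complex.norm_real, Real.norm_of_nonneg (hΨ0 x)]
  refine ⟨g', hg'i, hg'2, ?_, ?_, ?_, ?_⟩
  · -- Fourier support: `[-ρ, ρ] + Y(2Lⁿ) ⊂ Y(2L^{n+1+T})`
    intro ξ hξ
    apply convolution_eq_zero_of_notMem_add hwf_zero hgY
    intro hmem
    apply hξ
    obtain ⟨a, ha, b, hb, rfl⟩ := hmem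
    have ha' : |a| ≤ ρ := by
      rw [abs_le]; exact ⟨ha.1, ha.2⟩
    have := add_mem_cthickening (by positivity) ha' hb
    refine Metric.cthickening_mono ?_ Y this
    -- 2 Lⁿ + ρ ≤ 2 ρ
    have : (2 : ℝ) * (L : ℝ) ^ n ≤ ρ := by
      rw [hρdef, add_assoc, pow_add]
      have : (2 : ℝ) ≤ (L : ℝ) ^ (1 + T) := by
        calc (2 : ℝ) ≤ L := by exact_mod_cast hL2
          _ = (L : ℝ) ^ 1 := (pow_one _).symm
          _ ≤ (L : ℝ) ^ (1 + T) := pow_le_pow_right₀ hL1 (by omega)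
      rw [mul_comm]
      exact mul_le_mul_of_nonneg_left this (by positivity)
    linarith
  · -- `|𝓕⁻ g'| ≤ |𝓕⁻ g|`
    intro x
    rw [hnormFg' x]
    exact mul_le_of_le_one_left (norm_nonneg _) (hΨ1 x)
  · -- lower bound on `X` (BD18 Lemma 3.4)
    intro x hx
    rw [hnormFg' x]
    apply mul_le_mul_of_nonneg_right _ (norm_nonneg _)
    have hsub := Icc_subset_cellUnion (X := X) hw hx
    have := le_weight_of_Icc_subset (U := U) hUm hφ0 hφi hρ (x := x) (r := w / 10) hsub
    rw [show ρ * (w / 10) = (L : ℝ) ^ T / 10 by rw [← hρw]; ring] at this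
    exact this
  · -- the `L²` bound, from `H`
    -- the rescaled function `g̃(η) = √c · g(cη)` vanishes off `Ỹ = c⁻¹ • Y(2c)`
    have hgti : Integrable (fun η => (Real.sqrt c : ℂ) * g (c * η)) := integrable_rescale hg hc.ne'
    have hgt2 : MemLp (fun η => (Real.sqrt c : ℂ) * g (c * η)) 2 volume :=
      memLp_two_rescale hg hg2 hc
    have hgt0 : ∀ η, η ∉ c⁻¹ • Metric.cthickening (2 * c) Y →
        (Real.sqrt c : ℂ) * g (c * η) = 0 := fun η hη => rescale_eq_zero hgY hc.ne' hη
    have hSreg : IsRegularSet (c⁻¹ • Metric.cthickening (2 * c) Y) δ (800 * C_R) 1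
        (10 * (N / c)) := isRegularSet_rescaled_cthickening hδ0 hδ1.le hC hYreg hc2 hcN
    have hSsub := rescaled_cthickening_subset hY hYreg.2.1 hc hcN
    have hα₁ : (2 : ℝ) ≤ 10 * (N / c) := by
      have : 1 ≤ N / c := by rw [le_div_iff₀ hc, one_mul]; exact hcN
      linarith
    -- `X`-free children (BD18 Lemma 2.10) and the centres `t j` of the intervals `I'_j`
    have hn₀ : N⁻¹ ≤ w := inv_anti₀ (by positivity) hnN
    have hn₁ : (L : ℝ) * w ≤ 1 := by
      rw [hwc, mul_inv, mul_comm, mul_assoc, inv_mul_cancel₀ hL.ne', mul_one]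
      exact inv_le_one_of_one_le₀ (by linarith)
    have hcell : ∀ j : ℤ, ∃ k : ℤ, (L : ℤ) * j ≤ k ∧ k < L * j + L ∧
        Disjoint X (Icc ((k : ℝ) * w) (((k : ℝ) + 1) * w)) := by
      intro j
      obtain ⟨ℓ, hℓ, hempty⟩ := hXreg.exists_missing_cell hδ0 hδ1 hC hLreg
        (a := (((L : ℤ) * j : ℤ) : ℝ) * w) hw hn₀ hn₁
      refine ⟨L * j + ℓ, by omega, by omega, ?_⟩
      rw [Set.disjoint_iff_inter_eq_empty]
      convert hempty using 3 <;> push_cast <;> ring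
    choose kf hkf using hcell
    set t : ℤ → ℝ := fun j => ((kf j : ℝ) + 2⁻¹) / L with htdef
    have ht : ∀ j : ℤ, Icc (t j - (4 * (L : ℝ))⁻¹) (t j + (4 * (L : ℝ))⁻¹) ⊆
        Icc (j : ℝ) ((j : ℝ) + 1) := by
      intro j
      obtain ⟨h1, h2, -⟩ := hkf j
      have h1' : (L : ℝ) * j ≤ kf j := by exact_mod_cast h1
      have h2' : (kf j : ℝ) + 1 ≤ L * j + L := by
        have : kf j + 1 ≤ (L : ℤ) * j + L := h2
        exact_mod_cast this
      have e1 : t j - (4 * (L : ℝ))⁻¹ = ((kf j : ℝ) + 4⁻¹) / L := by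
        simp only [htdef]; field_simp; ring
      have e2 : t j + (4 * (L : ℝ))⁻¹ = ((kf j : ℝ) + 3 / 4) / L := by
        simp only [htdef]; field_simp; ring
      rw [e1, e2]
      apply Icc_subset_Icc
      · rw [le_div_iff₀ hL]; linarith
      · rw [div_le_iff₀ hL]; linarith
    -- Proposition 3.1 for `g̃`, rescaled back (BD18 (3.28))
    set F : ℝ → ℝ := fun x => ‖(𝓕⁻ g : ℝ → ℂ) x‖ ^ 2 with hFdef
    have hFx : ∀ x, F x = ‖(𝓕⁻ g : ℝ → ℂ) x‖ ^ 2 := fun x => rfl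
    set V : Set ℝ := c⁻¹ • ⋃ j : ℤ, Icc (t j - (4 * (L : ℝ))⁻¹) (t j + (4 * (L : ℝ))⁻¹)
      with hVdef
    have hH : c₃ * ∫ ξ, ‖g ξ‖ ^ 2 ≤ ∫ y in V, F y := by
      have := H (10 * (N / c)) hα₁ _ hSsub hSreg t ht _ hgti hgt2 hgt0
      rw [integral_norm_sq_rescale_eq hc, setIntegral_norm_sq_fourierInv_rescale_eq hc] at this
      exact this
    have hVeq : V = ⋃ j : ℤ, Icc (c⁻¹ * (t j - (4 * (L : ℝ))⁻¹)) (c⁻¹ * (t j + (4 * (L : ℝ))⁻¹)) := by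
      rw [hVdef, Set.smul_set_iUnion]
      congr 1
      funext j
      exact LinearOrderedField.smul_Icc (inv_pos.2 hc)
    have hVm : MeasurableSet V := hVeq ▸ MeasurableSet.iUnion fun _ => measurableSet_Icc
    -- `Ψ ≤ 1 - m_B` on `V = L^{-n} U'` (BD18: `Ψ_n ≤ c_φ` on `L^{-n}U'`)
    set mB : ℝ := ∫ z in Icc (-((L : ℝ) ^ T / 8)) ((L : ℝ) ^ T / 8), φ z with hmBdef
    have hmB1 : mB ≤ 1 := mass_Icc_le_one hφ0 hφi hφ1 _
    have hmB0 : 0 ≤ mB := integral_nonneg hφ0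
    have hΨV : ∀ x ∈ V, Ψ x ≤ 1 - mB := by
      intro x hx
      rw [hVdef, Set.mem_smul_set] at hx
      obtain ⟨y, hy, rfl⟩ := hx
      obtain ⟨j, hj⟩ := mem_iUnion.1 hy
      obtain ⟨-, -, hdis⟩ := hkf j
      simp only [mem_Icc] at hj
      have hxw : |c⁻¹ • y - ((kf j : ℝ) + 2⁻¹) * w| ≤ w / 4 := by
        have e : c⁻¹ • y - ((kf j : ℝ) + 2⁻¹) * w = c⁻¹ * (y - t j) := by
          simp only [htdef, smul_eq_mul, hwc]; field_simp; try ring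
        rw [e, abs_mul, abs_of_pos (inv_pos.2 hc)]
        have hyt : |y - t j| ≤ (4 * (L : ℝ))⁻¹ := by
          rw [abs_le]; constructor <;> linarith [hj.1, hj.2]
        calc c⁻¹ * |y - t j| ≤ c⁻¹ * (4 * (L : ℝ))⁻¹ := by gcongr
          _ = w / 4 := by rw [hwc]; field_simp; try ring
      have hdisj := disjoint_Icc_cellUnion (X := X) hw hdis hxw
      have := weight_le_of_disjoint (U := U) hφ0 hφi hφ1 hρ (x := c⁻¹ • y) (r := w / 8) hdisj
      rw [show ρ * (w / 8) = (L : ℝ) ^ T / 8 by rw [← hρw]; ring] at this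
      exact this
    -- the `L²` computation (BD18 (3.29))
    have hFi : Integrable F := integrable_norm_sq_fourierInv hg hg2
    have hPl : ∫ x, F x = ∫ ξ, ‖g ξ‖ ^ 2 := integral_norm_sq_fourierInv_eq hg hg2
    have hInt' : Integrable (fun x => ‖(𝓕⁻ g' : ℝ → ℂ) x‖ ^ 2) :=
      integrable_norm_sq_fourierInv hg'i hg'2
    have hInd : Integrable (V.indicator F) := hFi.indicator hVm
    have hcT0 : 0 ≤ 1 - mB := by linarith
    have hpt : ∀ x, ‖(𝓕⁻ g' : ℝ → ℂ) x‖ ^ 2 ≤ F x - (1 - (1 - mB) ^ 2) * V.indicator F x := by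
      intro x
      rw [hnormFg' x, mul_pow, ← hFx x]
      have hF0 : 0 ≤ F x := by rw [hFx]; positivity
      by_cases hxV : x ∈ V
      · rw [indicator_of_mem hxV]
        have h1 : Ψ x ^ 2 ≤ (1 - mB) ^ 2 := pow_le_pow_left₀ (hΨ0 x) (hΨV x hxV) 2
        have := mul_le_mul_of_nonneg_right h1 hF0
        nlinarith
      · rw [indicator_of_notMem hxV, mul_zero, sub_zero]
        have h1 : Ψ x ^ 2 ≤ 1 := pow_le_one₀ (hΨ0 x) (hΨ1 x)
        calc Ψ x ^ 2 * F x ≤ 1 * F x := mul_le_mul_of_nonneg_right h1 hF0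
          _ = F x := one_mul _
    have h1cT : 0 ≤ 1 - (1 - mB) ^ 2 := by nlinarith
    have hstep1 : ∫ x, ‖(𝓕⁻ g' : ℝ → ℂ) x‖ ^ 2 ≤ ∫ x, (F x - (1 - (1 - mB) ^ 2) * V.indicator F x) :=
      integral_mono hInt' (hFi.sub (hInd.const_mul _)) hpt
    have hstep2 : ∫ x, (F x - (1 - (1 - mB) ^ 2) * V.indicator F x) =
        (∫ x, F x) - (1 - (1 - mB) ^ 2) * ∫ x in V, F x := by
      rw [integral_sub hFi (hInd.const_mul _), integral_const_mul, integral_indicator hVm]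
    have hstep3 : (1 - (1 - mB) ^ 2) * (c₃ * ∫ ξ, ‖g ξ‖ ^ 2) ≤
        (1 - (1 - mB) ^ 2) * ∫ x in V, F x := mul_le_mul_of_nonneg_left hH h1cT
    have key : ∀ A : ℝ, A - (1 - (1 - mB) ^ 2) * (c₃ * A) = (1 - (1 - (1 - mB) ^ 2) * c₃) * A := by
      intro A; ring
    calc ∫ x, ‖(𝓕⁻ g' : ℝ → ℂ) x‖ ^ 2
        ≤ (∫ x, F x) - (1 - (1 - mB) ^ 2) * ∫ x in V, F x := hstep2 ▸ hstep1
      _ ≤ (∫ x, F x) - (1 - (1 - mB) ^ 2) * (c₃ * ∫ ξ, ‖g ξ‖ ^ 2) := by linarith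
      _ = (∫ x, F x) - (1 - (1 - mB) ^ 2) * (c₃ * ∫ x, F x) := by rw [hPl]
      _ = (1 - (1 - (1 - mB) ^ 2) * c₃) * ∫ x, F x := key _

end Literature.Analysis.Fourier
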